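import Literature.AlgebraicGeometry.Morphisms.ArtinianLiftsOfSmoothEtale   -- ★ `exists_lift_of_smooth_of_isNilpotent` (smooth ⇒ lifts, any base)
import Literature.AlgebraicGeometry.Morphisms.SmoothOfArtinianLifts        -- ★ `smooth_of_artinianLifts` ([EGAIV4] (17.14.2), scheme form)
import Mathlib.AlgebraicGeometry.Morphisms.Smooth
import Mathlib.RingTheory.Artinian.Ring
import HarnessLib

/-!
# Artinian lifts from smoothness OVER AN OPEN of the base; the split «residue characteristic `p` ∕ prime to `p`» of
# [EGA IV₄] (17.14.2)

Topic `Literature/AlgebraicGeometry/Morphisms`; namespace `Literature.AlgebraicGeometry.Morphisms`.  THEOREMS ONLY (no definition, no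
named fact, no instance, no notation, no `sorry`).  Cell `hodgecm-mathlib`, P6 «MOD programme», sub-desk P6d census v1 §(iv) organ (G3) =
socket `stub_L4B5b` («(b-0): lifts where `p` is a unit, from `Smooth (ω ∣_ S[1/p])`») of `Cruxes/HLiu418/Lines/F0_P6d_LubinTateFormalModuli.lean`
§2¾, and the Literature twin of that file's Row-4 glue head `L4B5_smooth_of_line`.  HC_CM is proved only modulo the printed citations until
rung 0 closes; nothing here is about HC.

THE PRINT.  [EGAIV4] Prop. (17.1.6) with Déf. (17.1.1)∕(17.3.1) ([StacksProject] Tag 02H6): a smooth morphism is formally smooth — points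
with values in a local ring lift along surjections with nilpotent kernel (tree: ★ `Morphisms.exists_lift_of_smooth_of_isNilpotent`, any base);
[EGAIV4] Prop. (17.14.2): conversely, over a locally Noetherian base, lifting at ARTINIAN local points along small surjections implies smoothness
(tree: ★ `Morphisms.smooth_of_artinianLifts`).  When the smoothness hypothesis is only available over an OPEN `U ⊆ S` — the case in point is
`U = S[1/p] = S.basicOpen p` for an integral model `ω : 𝓜 → S = Spec 𝒪_{E,(ν)}` whose generic fibre is known to be smooth ([RapoportSmithlingZhang2020Diagonal] Thm. 4.1,
«`𝓜 ⊗ E ≅ M_{K_G̃}(G̃)`» is a Shimura variety) — the lifting still holds at every test point `Spec R′ → S` landing in `U`, because one-point test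
schemes factor through `U` and through `ω⁻¹(U)`, where `ω ∣_ U` is smooth.  In an Artinian local ring a natural number `p` is nilpotent or a
unit, and `p` a unit means exactly that `Spec A → S` lands in `S[1/p]`; so (17.14.2)'s hypothesis SPLITS into «lifts at Artinian points of
residue characteristic `p`» (the deformation-theoretic input: Serre–Tate, Grothendieck–Messing, Lubin–Tate — [HarrisTaylor2001] Lemma III.4.1,
[RapoportSmithlingZhang2020Diagonal] Thm. 4.3) and «`ω` is smooth over `S[1/p]`».

MAIN STATEMENTS.
* **`exists_lift_of_smooth_morphismRestrict`** — `ω : Z ⟶ S`, `U : S.Opens` with `Smooth (ω ∣_ U)`; `R′` local, `π : R′ ↠ R` with nilpotent kernel,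
  `s : Spec R′ ⟶ S` with `range s ⊆ U`, `g : Spec R ⟶ Z` over `s` ⟹ `∃ g′ : Spec R′ ⟶ Z` over `s` restricting to `g`;
* `range_subset_basicOpen_of_isUnit_appTop` ∕ `range_subset_basicOpen_of_isUnit_natCast` — a point `Spec R′ → S` lands in `S.basicOpen r`
  as soon as `r` becomes a unit in `Γ(Spec R′)` (resp. `p` is a unit in `R′`);
* **`liftsWherePUnit_of_smooth_restrict_basicOpen`** — THE LETTER `StubL4B5bStatement` of the P6d line, UNFOLDED token for token:
  `Smooth (ω ∣_ S.basicOpen (p : Γ(S, ⊤)))` ⟹ for every Artinian local `A` with `IsUnit (p : A)`, every `J ≠ ⊤` with `𝔪_A·J = ⊥`, every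
  `a : Spec A ⟶ S` and `z₀ : Spec (A⧸J) ⟶ Z` over `a`, a lift `z : Spec A ⟶ Z` with `z ≫ ω = a` restricting to `z₀`;
* `isNilpotent_or_isUnit_of_isArtinianRing` — in an Artinian local ring every element is nilpotent or a unit;
* **`smooth_of_liftsWherePNilpotent_of_smooth_restrict_basicOpen`** — the Literature twin of the glue head: `ω` locally of finite type over a
  locally Noetherian `S`, lifts at Artinian local points with `p` nilpotent, and `Smooth (ω ∣_ S.basicOpen p)` ⟹ `Smooth ω`.

## References
* [EGAIV4] A. Grothendieck, J. Dieudonné, *Éléments de géométrie algébrique* IV₄, Publ. Math. IHÉS 32 (1967): Déf. (17.1.1), Prop. (17.1.6),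
  Déf. (17.3.1), Prop. (17.14.2) (p. 98).
* [StacksProject] The Stacks Project, Tag 02H6 (infinitesimal lifting criterion for smooth morphisms).
* [HarrisTaylorAMS2001] M. Harris, R. Taylor, *The Geometry and Cohomology of Some Simple Shimura Varieties* (2001), Lemma III.4.1 (p. 108).
-/

universe u

open CategoryTheory CategoryTheory.Limits AlgebraicGeometry

noncomputable section

namespace Literature.AlgebraicGeometry.Morphisms

/-! ## §1 Lifts from smoothness over an open of the base -/

/-- **Smooth over an open `U ⊆ S` ⇒ infinitesimal lifting of the local points landing in `U`** ([EGAIV4] Prop. (17.1.6) for `ω ∣_ U`):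
`ω : Z ⟶ S`, `U : S.Opens`, `Smooth (ω ∣_ U)`; `R′` local, `π : R′ ↠ R` with nilpotent kernel; `s : Spec R′ ⟶ S` with `range s ⊆ U` and
`g : Spec R ⟶ Z` with `g ≫ ω = Spec π ≫ s`.  Then `∃ g′ : Spec R′ ⟶ Z`, `Spec π ≫ g′ = g`, `g′ ≫ ω = s`.  Proof: `s` factors through `U.ι`
and `g` through `(ω⁻¹ U).ι`; apply ★ `exists_lift_of_smooth_of_isNilpotent` to `ω ∣_ U` and compose back (`morphismRestrict_ι`).
[cite: EGAIV4, Déf. (17.1.1), Prop. (17.1.6) and Déf. (17.3.1)] [cite: StacksProject, Tag 02H6] -/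
theorem exists_lift_of_smooth_morphismRestrict {Z S : Scheme.{u}} (ω : Z ⟶ S) (U : S.Opens) [Smooth (ω ∣_ U)]
    {R R' : CommRingCat.{u}} [IsLocalRing R'] (π : R' ⟶ R) (hπ : Function.Surjective π.hom)
    (hnil : IsNilpotent (RingHom.ker π.hom)) (s : Spec R' ⟶ S) (hs : Set.range s ⊆ (U : Set S))
    (g : Spec R ⟶ Z) (w : g ≫ ω = Spec.map π ≫ s) :
    ∃ g' : Spec R' ⟶ Z, Spec.map π ≫ g' = g ∧ g' ≫ ω = s := by
  -- `s` factors through `U.ι`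
  have hsU : Set.range s ⊆ Set.range U.ι := by rwa [Scheme.Opens.range_ι]
  let s₀ : Spec R' ⟶ (U : Scheme.{u}) := IsOpenImmersion.lift U.ι s hsU
  have hs₀ : s₀ ≫ U.ι = s := IsOpenImmersion.lift_fac U.ι s hsU
  -- `g` factors through `(ω ⁻¹ᵁ U).ι`
  have hgU : Set.range g ⊆ Set.range (ω ⁻¹ᵁ U).ι := by
    rw [Scheme.Opens.range_ι]
    rintro _ ⟨t, rfl⟩
    have ht : ω (g t) = s (Spec.map π t) := by
      rw [← Scheme.Hom.comp_apply, w, Scheme.Hom.comp_apply]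
    show ω (g t) ∈ U
    rw [ht]
    exact hs ⟨_, rfl⟩
  let g₀ : Spec R ⟶ (ω ⁻¹ᵁ U : Scheme.{u}) := IsOpenImmersion.lift (ω ⁻¹ᵁ U).ι g hgU
  have hg₀ : g₀ ≫ (ω ⁻¹ᵁ U).ι = g := IsOpenImmersion.lift_fac _ _ _
  -- compatibility over `U`
  have w₀ : g₀ ≫ (ω ∣_ U) = Spec.map π ≫ s₀ := by
    rw [← cancel_mono U.ι, Category.assoc, morphismRestrict_ι, ← Category.assoc, hg₀, w, Category.assoc, hs₀]
  -- ★ smooth ⇒ lifts, for `ω ∣_ U`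
  obtain ⟨g₁, h₁, h₂⟩ := exists_lift_of_smooth_of_isNilpotent (ω ∣_ U) π hπ hnil s₀ g₀ w₀
  refine ⟨g₁ ≫ (ω ⁻¹ᵁ U).ι, ?_, ?_⟩
  · rw [← Category.assoc, h₁, hg₀]
  · rw [Category.assoc, ← morphismRestrict_ι, ← Category.assoc, h₂, hs₀]

/-! ## §2 Points at which a global section is invertible land in its basic open -/

/-- A point `s : Spec R′ ⟶ S` such that `r ∈ Γ(S, ⊤)` becomes a unit in `Γ(Spec R′, ⊤)` lands in `S.basicOpen r`
(`s⁻¹(S_r) = (Spec R′)_{s^*(r)} = ⊤`). [cite: EGAIV4, Déf. (17.1.1)] -/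
theorem range_subset_basicOpen_of_isUnit_appTop {S : Scheme.{u}} {R' : CommRingCat.{u}} (s : Spec R' ⟶ S) (r : Γ(S, ⊤))
    (hr : IsUnit (s.appTop r)) : Set.range s ⊆ (S.basicOpen r : Set S) := by
  rintro _ ⟨t, rfl⟩
  have ht : t ∈ s ⁻¹ᵁ S.basicOpen r := by
    rw [Scheme.preimage_basicOpen_top, Scheme.basicOpen_of_isUnit _ hr]
    trivial
  exact ht

/-- A point `s : Spec R′ ⟶ S` with `p` a unit in `R′` lands in `S[1/p] = S.basicOpen p`. [cite: EGAIV4, Déf. (17.1.1)] -/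
theorem range_subset_basicOpen_of_isUnit_natCast {S : Scheme.{u}} {R' : CommRingCat.{u}} (s : Spec R' ⟶ S) (p : ℕ)
    (hp : IsUnit (p : R')) : Set.range s ⊆ (S.basicOpen ((p : ℕ) : Γ(S, ⊤)) : Set S) := by
  refine range_subset_basicOpen_of_isUnit_appTop s _ ?_
  rw [map_natCast]
  have h := hp.map (Scheme.ΓSpecIso R').inv.hom
  rwa [map_natCast] at h

/-! ## §3 THE LETTER (b-0): lifts at Artinian points where `p` is a unit, from `Smooth (ω ∣_ S[1/p])` -/

/-- **Letter `StubL4B5bStatement` of `Cruxes/HLiu418/Lines/F0_P6d_LubinTateFormalModuli.lean` (§2¾ socket (b-0)), UNFOLDED token for token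
and PROVED**: if `ω` is smooth over the open `S[1/p] = S.basicOpen p`, then `ω`-points lift at every Artinian local point `a : Spec A ⟶ S` with
`IsUnit (p : A)` along every small surjection `A ↠ A⧸J` (`J ≠ ⊤`, `𝔪_A·J = ⊥`): such an `a` factors through `S[1/p]`
(`range_subset_basicOpen_of_isUnit_natCast`), `J² ⊆ 𝔪_A J = 0` is nilpotent, and `exists_lift_of_smooth_morphismRestrict` applies.  The line closes
`stub_L4B5b` by this name after `unfold StubL4B5bStatement LiftsWherePUnit ArtinianLiftsWhere`.
[cite: EGAIV4, Prop. (17.1.6) and Déf. (17.3.1)] [cite: StacksProject, Tag 02H6] [cite: HarrisTaylorAMS2001, Lemma III.4.1 (p. 108)] -/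
theorem liftsWherePUnit_of_smooth_restrict_basicOpen (Z S : Scheme.{u}) (ω : Z ⟶ S) (p : ℕ)
    (hω : Smooth (ω ∣_ S.basicOpen ((p : ℕ) : Γ(S, ⊤)))) :
    ∀ (A : Type u) [CommRing A] [IsArtinianRing A] [IsLocalRing A], IsUnit (p : A) → ∀ (J : Ideal A), J ≠ ⊤ →
      IsLocalRing.maximalIdeal A * J = ⊥ →
      ∀ (a : Spec (.of A) ⟶ S) (z₀ : Spec (.of (A ⧸ J)) ⟶ Z),
        z₀ ≫ ω = Spec.map (CommRingCat.ofHom (Ideal.Quotient.mk J)) ≫ a →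
        ∃ z : Spec (.of A) ⟶ Z, z ≫ ω = a ∧ Spec.map (CommRingCat.ofHom (Ideal.Quotient.mk J)) ≫ z = z₀ := by
  intro A _ _ _ hp J hJ hmJ a z₀ h
  haveI := hω
  have hsurj : Function.Surjective (CommRingCat.ofHom (Ideal.Quotient.mk J)).hom := Ideal.Quotient.mk_surjective
  have hnil : IsNilpotent (RingHom.ker (CommRingCat.ofHom (Ideal.Quotient.mk J)).hom) := by
    refine ⟨2, ?_⟩
    rw [CommRingCat.hom_ofHom, Ideal.mk_ker, pow_two]
    exact eq_bot_iff.mpr ((Ideal.mul_mono_left (IsLocalRing.le_maximalIdeal hJ)).trans hmJ.le)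
  obtain ⟨z, hz₁, hz₂⟩ := exists_lift_of_smooth_morphismRestrict ω (S.basicOpen ((p : ℕ) : Γ(S, ⊤)))
    (CommRingCat.ofHom (Ideal.Quotient.mk J)) hsurj hnil a (range_subset_basicOpen_of_isUnit_natCast a p hp) z₀ h
  exact ⟨z, hz₂, hz₁⟩

/-! ## §4 The split of (17.14.2): residue characteristic `p` ∕ prime to `p` -/

/-- In an Artinian local ring every element is nilpotent or a unit (the maximal ideal is the Jacobson radical, which is nilpotent).
[cite: StacksProject, Tag 00J8] -/
theorem isNilpotent_or_isUnit_of_isArtinianRing (A : Type u) [CommRing A] [IsArtinianRing A] [IsLocalRing A] (x : A) :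
    IsNilpotent x ∨ IsUnit x := by
  by_cases hx : IsUnit x
  · exact Or.inr hx
  · left
    have hmem : x ∈ Ideal.jacobson (⊥ : Ideal A) := by
      rw [IsLocalRing.jacobson_eq_maximalIdeal ⊥ bot_ne_top]
      exact (IsLocalRing.mem_maximalIdeal x).mpr hx
    obtain ⟨n, hn⟩ := IsArtinianRing.isNilpotent_jacobson_bot (R := A)
    refine ⟨n, ?_⟩
    have h : x ^ n ∈ (Ideal.jacobson (⊥ : Ideal A)) ^ n := Ideal.pow_mem_pow hmem n
    rw [hn] at h
    simpa using h

/-- **[EGA IV₄] (17.14.2) SPLIT at `p`: smoothness from (i) lifts at Artinian local points of residue characteristic `p` and (ii) smoothness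
over `S[1/p]`.**  `ω : Z ⟶ S` locally of finite type, `S` locally Noetherian; if `ω`-points lift along small surjections `A ↠ A⧸J` of Artinian
local rings in which `p` is NILPOTENT, and `ω ∣_ S.basicOpen p` is smooth, then `ω` is smooth — ★ `smooth_of_artinianLifts` with its hypothesis
split by `isNilpotent_or_isUnit_of_isArtinianRing` into (i) and `liftsWherePUnit_of_smooth_restrict_basicOpen`.  (The Literature twin of the
P6d line's glue head `L4B5_smooth_of_line`, with (b-0) discharged.)
[cite: EGAIV4, Prop. (17.14.2), p. 98] [cite: HarrisTaylorAMS2001, Lemma III.4.1 (p. 108)] -/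
theorem smooth_of_liftsWherePNilpotent_of_smooth_restrict_basicOpen {Z S : Scheme.{u}} (ω : Z ⟶ S) [LocallyOfFiniteType ω]
    [IsLocallyNoetherian S] (p : ℕ)
    (hnil : ∀ (A : Type u) [CommRing A] [IsArtinianRing A] [IsLocalRing A], IsNilpotent (p : A) → ∀ (J : Ideal A), J ≠ ⊤ →
      IsLocalRing.maximalIdeal A * J = ⊥ →
      ∀ (a : Spec (.of A) ⟶ S) (z₀ : Spec (.of (A ⧸ J)) ⟶ Z),
        z₀ ≫ ω = Spec.map (CommRingCat.ofHom (Ideal.Quotient.mk J)) ≫ a →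
        ∃ z : Spec (.of A) ⟶ Z, z ≫ ω = a ∧ Spec.map (CommRingCat.ofHom (Ideal.Quotient.mk J)) ≫ z = z₀)
    (hω : Smooth (ω ∣_ S.basicOpen ((p : ℕ) : Γ(S, ⊤)))) : Smooth ω := by
  refine smooth_of_artinianLifts ω ?_
  intro A _ _ _ J hJ hmJ a z₀ h
  rcases isNilpotent_or_isUnit_of_isArtinianRing A (p : A) with hn | hu
  · exact hnil A hn J hJ hmJ a z₀ h
  · exact liftsWherePUnit_of_smooth_restrict_basicOpen Z S ω p hω A hu J hJ hmJ a z₀ h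

end Literature.AlgebraicGeometry.Morphisms
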